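import Summits.CriticalPhenomena.PercolationContinuityZ3.Theorems.PercNearOneGluingNearOneGluingFreshPocketAveraging
import HarnessLib

/-!
# Crux `PercNearOneGluing.NoHeavyLowerTail` (stmt-CriticalPhenomena-4575), line `comonotone-deadzone` —
# the DEAD-ZONE DECOMPOSITION (the bad event is an average over the dead zone of a fresh connection function)

Prover `prover-rtask-CriticalPhenomena-PercNearOneG-529c20ca-0` (strategy (a), domination), 2026-08-17.
Lands with `--supports stmt-CriticalPhenomena-4575`.

Notation: `μ = prodBernoulli w` on bond configurations of the complete graph on `Fin n`, relay set `A`,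
observer `o`, target `b`, `C(b) = openCluster · b`, `{C(b) = K} = clusterIs b K`.

* `deadZone_fibre` — on the fibre `{C(b) = K}` with `o ∉ K`, the bad event `{o ↔ A} ∩ {o ↮ b}` IS the event
  `⋃_{a ∈ A} {o ↔ a inside Kᶜ}` (an open walk from `o` never meets `C(b)`); with `o ∈ K` the fibre misses
  the bad event.
* `deadZone_fibre_real` — spatial Markov property: `μ({C(b) = K} ∩ ⋃_a {o ↔ a inside Kᶜ}) =
  μ(C(b) = K) · μ(⋃_a {o ↔ a inside Kᶜ})` (disjoint supports: pairs touching `K` / pairs inside `Kᶜ`).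
* `deadZone_decomposition` — **the identity**
  `μ(o ↔ A, o ↮ b) = Σ_{K ∌ o} μ(C(b) = K) · μ(⋃_{a ∈ A} {o ↔ a inside Kᶜ})`,
  i.e. `bad = E[1{o ∈ D} g(D)]` for the dead zone `D = V ∖ C(b)` and the FRESH connection function
  `g(S) = μ(o ↔ A inside S)`.  The registered stub of the line (`stub_comonotoneDeadZone`, S2) says exactly
  that this average is dominated by the average of `g` over the comonotone rearrangement of `D` — the
  level sets `{v | t ≤ μ(v ↮ b)} ∪ {o}`, `t ∈ (0, 1]` — which has the same one-point marginals
  (`deadZone_marginal`: `μ(v ∉ C(b)) = μ(v ↮ b)`).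
-/

namespace Summit.CriticalPhenomena.PercolationContinuityZ3.Theorems

open scoped BigOperators Classical
open MeasureTheory Set
open Literature.Probability.LatticeModels (prodBernoulli prodBernoulli_real_inter_of_determinedBy)
open Literature.Probability.Percolation
open Literature.Barriers.CriticalPhenomena (pathIn_of_walk_support_subset)

section DeadZone

variable {n : ℕ}

/-- On `{C(b) = K}` with `o ∉ K`, no open walk from `o` meets `K`. [folklore; Grimmett 1999 §1.3] -/
theorem deadZone_reachable_notMem {K : Finset (Fin n)} {o b : Fin n} {ω : BondConfig (Fin n)}
    (hK : ω ∈ clusterIs b K) (ho : o ∉ K) {v : Fin n} (hv : (openGraph ω).Reachable o v) :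
    v ∉ (↑K : Set (Fin n)) := by
  intro hvK
  rw [mem_clusterIs] at hK
  have hbv : (openGraph ω).Reachable b v := by
    have : v ∈ openCluster ω b := by rw [hK]; exact hvK
    exact this
  have hob : o ∈ openCluster ω b := hbv.trans hv.symm
  rw [hK] at hob
  exact ho (by exact_mod_cast hob)

/-- **The fibre of the bad event over the dead zone.**  On `{C(b) = K}` with `o ∉ K`:
`{o ↔ A} ∩ {o ↮ b} = ⋃_{a ∈ A} {o ↔ a inside Kᶜ}`. [folklore; Grimmett 1999 §1.3] -/
theorem deadZone_fibre (A K : Finset (Fin n)) {o : Fin n} (b : Fin n) (ho : o ∉ K) :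
    clusterIs b K ∩ ((⋃ a ∈ A, openConn o a) ∩ (openConn o b)ᶜ) =
      clusterIs b K ∩ ⋃ a ∈ A, openConnIn ((↑K : Set (Fin n))ᶜ) o a := by
  ext ω
  constructor
  · rintro ⟨hK, hA, -⟩
    refine ⟨hK, ?_⟩
    rw [Set.mem_iUnion₂] at hA ⊢
    obtain ⟨a, ha, hoa⟩ := hA
    obtain ⟨p⟩ := (hoa : (openGraph ω).Reachable o a)
    have hsupp : ∀ v ∈ p.support, v ∈ ((↑K : Set (Fin n))ᶜ) := fun v hv =>
      deadZone_reachable_notMem hK ho ⟨p.takeUntil v hv⟩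
    exact ⟨a, ha, DCT16.mem_openConnIn_of_pathIn (pathIn_of_walk_support_subset p hsupp)⟩
  · rintro ⟨hK, hA⟩
    refine ⟨hK, ?_, ?_⟩
    · exact Set.iUnion₂_mono (fun a _ => openConnIn_subset_openConn _ o a) hA
    · intro hob
      have hbK : b ∈ (↑K : Set (Fin n)) := by
        have : b ∈ openCluster ω b := mem_openCluster_self ω b
        rwa [mem_clusterIs.1 hK] at this
      exact deadZone_reachable_notMem hK ho hob hbK

/-- On `{C(b) = K}` with `o ∈ K`, `o ↔ b`: the fibre misses the bad event. [folklore] -/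
theorem deadZone_fibre_empty (A K : Finset (Fin n)) {o : Fin n} (b : Fin n) (ho : o ∈ K) :
    clusterIs b K ∩ ((⋃ a ∈ A, openConn o a) ∩ (openConn o b)ᶜ) = (∅ : Set (BondConfig (Fin n))) := by
  refine Set.eq_empty_of_forall_notMem fun ω hω => ?_
  obtain ⟨hK, -, hob⟩ := hω
  apply hob
  have : o ∈ openCluster ω b := by rw [mem_clusterIs.1 hK]; exact_mod_cast ho
  exact (this : (openGraph ω).Reachable b o).symm

/-- **Spatial Markov property at the cluster of `b`** (disjoint supports): `{C(b) = K}` is determined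
by the pairs touching `K`, `⋃_a {o ↔ a inside Kᶜ}` by the pairs inside `Kᶜ`, so they are independent
under the product measure. [folklore; Grimmett 1999 §2.2] -/
theorem deadZone_fibre_real (w : Sym2 (Fin n) → unitInterval) (A K : Finset (Fin n)) (o b : Fin n) :
    (prodBernoulli w).real (clusterIs b K ∩ ⋃ a ∈ A, openConnIn ((↑K : Set (Fin n))ᶜ) o a) =
      (prodBernoulli w).real (clusterIs b K) *
        (prodBernoulli w).real (⋃ a ∈ A, openConnIn ((↑K : Set (Fin n))ᶜ) o a) := by
  set F : Finset (Sym2 (Fin n)) := (Set.toFinite (edgesTouching (↑K : Set (Fin n)))).toFinset with hF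
  have hFc : (↑F : Set (Sym2 (Fin n))) = edgesTouching (↑K : Set (Fin n)) := by
    rw [hF, Set.Finite.coe_toFinset]
  refine prodBernoulli_real_inter_of_determinedBy w F ?_ ?_ MeasurableSet.of_discrete
    MeasurableSet.of_discrete
  · rw [hFc]; exact determinedBy_clusterIs b K
  · rw [hFc]
    have hdet : DeterminedBy (⋃ a ∈ A, openConnIn ((↑K : Set (Fin n))ᶜ) o a : Set (BondConfig (Fin n)))
        ((↑K : Set (Fin n))ᶜ).sym2 :=
      DeterminedBy.iUnion fun a => DeterminedBy.iUnion fun _ =>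
        DCT16.determinedBy_openConnIn _ o a le_rfl
    exact hdet.mono (disjoint_edgesTouching_compl_sym2 _).subset_compl_left

/-- **DEAD-ZONE DECOMPOSITION.**  On every finite weighted graph,
`μ(o ↔ A, o ↮ b) = Σ_{K ∌ o} μ(C(b) = K) · μ(⋃_{a ∈ A} {o ↔ a inside Kᶜ})`:
the bad event is the average, over the law of the dead zone `D = V ∖ C(b)` on `{o ∈ D}`, of the FRESH
probability that `o` is joined to `A` inside `D`. [folklore; Grimmett 1999 §1.3, §2.2] -/
theorem deadZone_decomposition (w : Sym2 (Fin n) → unitInterval) (A : Finset (Fin n)) (o b : Fin n) :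
    (prodBernoulli w).real ((⋃ a ∈ A, openConn o a) ∩ (openConn o b)ᶜ) =
      ∑ K ∈ (Finset.univ : Finset (Finset (Fin n))).filter (fun K => o ∉ K),
        (prodBernoulli w).real (clusterIs b K) *
          (prodBernoulli w).real (⋃ a ∈ A, openConnIn ((↑K : Set (Fin n))ᶜ) o a) := by
  set μ := prodBernoulli w with hμ
  set T : Set (BondConfig (Fin n)) := (⋃ a ∈ A, openConn o a) ∩ (openConn o b)ᶜ with hT
  -- the fibres `{C(b) = K}` cover everything
  have hcover : T = ⋃ K ∈ (Finset.univ : Finset (Finset (Fin n))), (clusterIs b K ∩ T) := by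
    ext ω
    simp only [Set.mem_iUnion, Finset.mem_univ, exists_true_left, Set.mem_inter_iff]
    constructor
    · intro hω
      refine ⟨(openCluster ω b).toFinset, ?_, hω⟩
      rw [mem_clusterIs, Set.coe_toFinset]
    · rintro ⟨K, -, hω⟩; exact hω
  have hdisj : ∀ K ∈ (Finset.univ : Finset (Finset (Fin n))), ∀ L ∈ (Finset.univ : Finset (Finset (Fin n))),
      K ≠ L → Disjoint (clusterIs b K ∩ T) (clusterIs b L ∩ T) :=
    fun K _ L _ hKL => Disjoint.mono Set.inter_subset_left Set.inter_subset_left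
      (pairwise_disjoint_clusterIs b hKL)
  calc μ.real T = μ.real (⋃ K ∈ (Finset.univ : Finset (Finset (Fin n))), (clusterIs b K ∩ T)) := by
        rw [← hcover]
    _ = ∑ K ∈ (Finset.univ : Finset (Finset (Fin n))), μ.real (clusterIs b K ∩ T) :=
        measureReal_biUnion_finset hdisj fun K _ => MeasurableSet.of_discrete
    _ = ∑ K ∈ (Finset.univ : Finset (Finset (Fin n))).filter (fun K => o ∉ K),
          μ.real (clusterIs b K ∩ T) := by
        symm
        refine Finset.sum_subset (Finset.filter_subset _ _) fun K _ hK => ?_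
        have ho : o ∈ K := by simpa [Finset.mem_filter] using hK
        rw [hT, deadZone_fibre_empty A K b ho, measureReal_empty]
    _ = ∑ K ∈ (Finset.univ : Finset (Finset (Fin n))).filter (fun K => o ∉ K),
          μ.real (clusterIs b K) * μ.real (⋃ a ∈ A, openConnIn ((↑K : Set (Fin n))ᶜ) o a) := by
        refine Finset.sum_congr rfl fun K hK => ?_
        have ho : o ∉ K := (Finset.mem_filter.1 hK).2
        rw [hT, deadZone_fibre A K b ho, deadZone_fibre_real]

/-- **Marginals of the dead zone**: `μ(v ∉ C(b)) = μ(v ↮ b)` — the dead zone `V ∖ C(b)` and its comonotone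
rearrangement (the level sets `{u ≥ t}`, `t` uniform in `(0,1]`, `u(v) = μ(v ↮ b)`) have the same one-point
marginals. [folklore] -/
theorem deadZone_marginal (w : Sym2 (Fin n) → unitInterval) (b v : Fin n) :
    (prodBernoulli w).real {ω : BondConfig (Fin n) | v ∉ openCluster ω b} =
      (prodBernoulli w).real (openConn v b)ᶜ := by
  congr 1
  ext ω
  simp only [Set.mem_setOf_eq, Set.mem_compl_iff]
  exact not_congr ⟨fun h => (h : (openGraph ω).Reachable b v).symm,
    fun h => (h : (openGraph ω).Reachable v b).symm⟩

/-- **Rearrangement reading of the stub.**  By `deadZone_decomposition`, comonotone dead-zone domination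
(S2) for `(w, A, o, b)` is literally the statement that the dead-zone average of the fresh connection
function `g(S) = μ(o ↔ A inside S)` is at most its average over the level sets of `u = μ(· ↮ b)`:
`Σ_{K ∌ o} μ(C(b) = K) g(Kᶜ) ≤ ∫₀¹ g({u ≥ t} ∪ {o}) dt`. [folklore] -/
theorem comonotoneDeadZone_iff_rearrangement (w : Sym2 (Fin n) → unitInterval) (A : Finset (Fin n))
    (o b : Fin n) :
    ((prodBernoulli w).real ((⋃ a ∈ A, openConn o a) ∩ (openConn o b)ᶜ) ≤
        ∫ t in (0 : ℝ)..1, (prodBernoulli w).real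
          (⋃ a ∈ A, openConnIn ({v : Fin n | t ≤ (prodBernoulli w).real (openConn v b)ᶜ} ∪ {o}) o a)) ↔
      (∑ K ∈ (Finset.univ : Finset (Finset (Fin n))).filter (fun K => o ∉ K),
          (prodBernoulli w).real (clusterIs b K) *
            (prodBernoulli w).real (⋃ a ∈ A, openConnIn ((↑K : Set (Fin n))ᶜ) o a) ≤
        ∫ t in (0 : ℝ)..1, (prodBernoulli w).real
          (⋃ a ∈ A, openConnIn ({v : Fin n | t ≤ (prodBernoulli w).real (openConn v b)ᶜ} ∪ {o}) o a)) := by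
  rw [deadZone_decomposition]

end DeadZone

end Summit.CriticalPhenomena.PercolationContinuityZ3.Theorems
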